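import Summits.Schanuel.Schanuel.Theorems.DiophantineDichotomyDefs
import HarnessLib

/-!
# Vocabulary of line `anchored-reduction` for crux `KhovanskiiApproxTypeEv` (stmt-Schanuel-14972)

Route `DiophantineDichotomy` (sub-problem `Schanuel/Schanuel`), crux
`Summit.Schanuel.Schanuel.Theses.DiophantineDichotomy.KhovanskiiApproxTypeEv` (the EVENTUAL-in-the-height
measure of simultaneous algebraic approximation `‖γ − θ‖ ≥ exp(−C(dᵃ log H + dᵇ))` for `H ≥ H₀(d)`,
`a < 1/(n−1)`, at every free Khovanskii point `θ = (s, e^s) ∈ ℂ²ⁿ`, `n ≥ 2`).  This is the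
**definitions module** of the line lead's skeleton (idea card
`Cruxes/KhovanskiiApproxTypeEv/Ideas/anchored-reduction.md`, line lead `prover-line-stmt-Schanuel-14972-0`,
`PICKED.md`): it carries, sorry-free, the skeleton's VOCABULARY (`ApproxTypeEvAt`, the pointwise eventual
type) and its registered STUB STATEMENTS as named `Prop`s, so that the stub files
`Theorems/DiophantineDichotomyKhovanskiiApproxTypeEv<StubName>.lean` (`--supports stmt-Schanuel-14972`)
and the closing skeleton share ONE copy of every object — exactly the pattern of
`Theorems/DiophantineDichotomyDefs.lean` for the sibling crux `KhovanskiiApproxType` (which is full: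
373/400 lines, hence this second module).  Nothing here is asserted: every `def … : Prop` is a
statement to be proved (by a registered stub) or a predicate; the one `theorem` is the `Iff.rfl`
reassembly `khovanskiiApproxTypeEv_iff`.

## The line in one paragraph

The numbers `1` and `iπ` are invisible to E-derivations (`D 1 = 0`; `D(e^{iπ}) = D(−1) = 0 = e^{iπ} D(iπ)`
forces `D(iπ) = 0`), so Kirby's induction behind the LANDED reduction `khovanskiiReduction_proof`
(`Theorems/DiophantineDichotomyKhovanskiiReduction.lean`) can be run inside the class of tuples
`x̄ = (1, iπ, x₂, …)`: Schanuel's conjecture follows from Schanuel at ANCHORED free Khovanskii points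
(`KhovanskiiSchanuelAnchored → SchanuelAnchored`, stub `stub_anchoredReduction`) and un-anchoring
(`SchanuelAnchored → Schanuel`, stub `stub_unanchoring`: `e^{q·x̄}` is algebraic over `ℚ(e^{x̄})`).  Hence
the ROUTE consumes the Diophantine crux only on `s = (1, iπ, s₃, …)` (`KhovanskiiApproxTypeEvAnchored`;
anchored race `ApproximationRaceEvAnchored`), whose `n = 2` layer is the single flagship point `(1, iπ)`,
i.e. the route item `EPiSimultaneousTypeEv` (stmt-Schanuel-14975).  The crux AS FILED is concluded by
name from three layers: `EvLWTwo` (Lindemann–Weierstrass points of `ℂ²`: theorem-grade from the vendored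
`Ably1994_lindemannWeierstrass_measure` through the landed penalty spine p85905/p94631), `EvNonLWTwo`
(OPEN: Schanuel-rank-2 strength pointwise) and `EvRankThreeUp` (OPEN: the crux for `n ≥ 3`).

Currency (as in the crux): `d` bounds `[ℚ(γ):ℚ]`, `H` the naive height of non-zero integer polynomials
of degree `≤ d` vanishing at the coordinates of the challenger `γ`; sup norm on `Fin n ⊕ Fin n → ℂ`.
-/

noncomputable section

-- `Summit.Schanuel.Schanuel.…` is the mandated summit/sub-problem namespace (single-conjunct summit), hence:
set_option linter.dupNamespace false

open scoped BigOperators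

namespace Summit.Schanuel.Schanuel.Cruxes.KhovanskiiApproxTypeEv.AnchoredReduction

open Summit.Schanuel.Schanuel.Theses.DiophantineDichotomy
  (KhovanskiiApproxTypeEv ApproximationProperty)
open Summit.Schanuel.Schanuel.Cruxes.KhovanskiiApproxType.LwSmallHeight (IsFreeKhovanskii)

/-! ## The crux, pointwise (bookkeeping; `khovanskiiApproxTypeEv_iff` is `Iff.rfl`) -/

/-- EVENTUAL APPROXIMATION TYPE `(a, b, C)` at `θ = (s, e^s) ∈ ℂ²ⁿ` — verbatim the tail of the crux
`KhovanskiiApproxTypeEv`: `C > 0` and for every degree budget `d` a threshold `H₀(d)` beyond which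
every algebraic challenger `γ` with `[ℚ(γ):ℚ] ≤ d`, coordinates roots of non-zero integer polynomials
of degree `≤ d` and height `≤ H`, satisfies `‖γ − θ‖ ≥ exp(−C(dᵃ log H + dᵇ))` (sup norm). -/
def ApproxTypeEvAt (n : ℕ) (s : Fin n → ℂ) (a b C : ℝ) : Prop :=
  0 < C ∧ ∀ d : ℕ, ∃ H₀ : ℕ, ∀ (H : ℕ) (γ : Fin n ⊕ Fin n → ℂ), H₀ ≤ H →
    Module.finrank ℚ ↥(IntermediateField.adjoin ℚ (Set.range γ)) ≤ d →
    (∀ i, ∃ P : Polynomial ℤ, P ≠ 0 ∧ P.natDegree ≤ d ∧ (∀ k, |P.coeff k| ≤ (H : ℤ)) ∧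
      Polynomial.aeval (γ i) P = 0) →
    Real.exp (-(C * ((d : ℝ) ^ a * Real.log H + (d : ℝ) ^ b))) ≤ ‖γ - Sum.elim s (Complex.exp ∘ s)‖

/-- The crux is, by `Iff.rfl`, the pointwise statement "every free Khovanskii point of `ℂⁿ`, `n ≥ 2`,
with `ℚ`-linearly independent coordinates has eventual approximation type `a < 1/(n−1)`". -/
theorem khovanskiiApproxTypeEv_iff :
    KhovanskiiApproxTypeEv ↔ ∀ (n : ℕ) (s : Fin n → ℂ), 2 ≤ n → LinearIndependent ℚ s →
      IsFreeKhovanskii n s → ∃ a b C : ℝ, a < 1 / ((n : ℝ) - 1) ∧ ApproxTypeEvAt n s a b C :=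
  Iff.rfl

/-! ## The anchored family `s = (1, iπ, s₂, …)` -/

/-- SCHANUEL'S CONJECTURE ON ANCHORED TUPLES: for every `ℚ`-linearly independent
`x̄ = (1, iπ, x₂, …, x_{n+1}) ∈ ℂⁿ⁺²` (literal anchors at the first two coordinates),
`trdeg_ℚ ℚ(x̄, e^{x̄}) ≥ n + 2`.  The conclusion is verbatim that of `_root_.Schanuel`
(`Literature.Periods.SchanuelConjecture`). -/
def SchanuelAnchored : Prop :=
  ∀ (n : ℕ) (x : Fin (n + 2) → ℂ), x 0 = 1 → x 1 = Complex.I * Real.pi → LinearIndependent ℚ x →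
    ((n + 2 : ℕ) : Cardinal) ≤ Algebra.trdeg ℚ
      ↥(IntermediateField.adjoin ℚ (Set.range x ∪ Set.range (Complex.exp ∘ x)))

/-- SCHANUEL AT ANCHORED FREE KHOVANSKII POINTS — the route's target `KhovanskiiSchanuel` restricted to
`s = (1, iπ, s₂, …)`: a `ℚ`-linearly independent anchored `s ∈ ℂⁿ⁺²` which is a non-degenerate zero of a
Khovanskii system over `ℚ` has `trdeg_ℚ ℚ(s, e^s) ≥ n + 2`. -/
def KhovanskiiSchanuelAnchored : Prop :=
  ∀ (n : ℕ) (s : Fin (n + 2) → ℂ), s 0 = 1 → s 1 = Complex.I * Real.pi → LinearIndependent ℚ s →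
    IsFreeKhovanskii (n + 2) s →
    ((n + 2 : ℕ) : Cardinal) ≤ Algebra.trdeg ℚ
      ↥(IntermediateField.adjoin ℚ (Set.range s ∪ Set.range (Complex.exp ∘ s)))

/-- `KhovanskiiReductionAnchored` — the ANCHORED REDUCTION (the card's first lemma): Schanuel's
conjecture follows from Schanuel at anchored free Khovanskii points.  In the skeleton it is
`stub_unanchoring ∘ stub_anchoredReduction`. -/
def KhovanskiiReductionAnchored : Prop :=
  KhovanskiiSchanuelAnchored → _root_.Schanuel

/-- THE CRUX ON THE ANCHORED FAMILY: eventual approximation type `a < 1/(n+1)` at every anchored free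
Khovanskii point `s = (1, iπ, s₂, …, s_{n+1}) ∈ ℂⁿ⁺²` (trivially implied by the crux,
`evAnchored_of_ev` in the skeleton; its `n = 0` layer is the single point `(1, iπ)`, i.e. the route item
`EPiSimultaneousTypeEv` up to coordinate bookkeeping). -/
def KhovanskiiApproxTypeEvAnchored : Prop :=
  ∀ (n : ℕ) (s : Fin (n + 2) → ℂ), s 0 = 1 → s 1 = Complex.I * Real.pi → LinearIndependent ℚ s →
    IsFreeKhovanskii (n + 2) s →
    ∃ a b C : ℝ, a < 1 / (((n + 2 : ℕ) : ℝ) - 1) ∧ ApproxTypeEvAt (n + 2) s a b C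

/-- `ApproximationRaceEvAnchored` — the EVENTUAL EXPONENT RACE on the anchored family (race
compactness pointwise, verbatim the race inside the route's deciding theorem `closes`): Philippon's
approximation property and the anchored crux give Schanuel at anchored free Khovanskii points. -/
def ApproximationRaceEvAnchored : Prop :=
  ApproximationProperty → KhovanskiiApproxTypeEvAnchored → KhovanskiiSchanuelAnchored

/-! ## The three layers of the crux as filed -/

/-- `EvLWTwo` — the LINDEMANN–WEIERSTRASS LAYER at `n = 2`: every `s ∈ ℚ̄²` with `ℚ`-linearly
independent coordinates (automatically a free Khovanskii point, `gᵢ = minpoly(sᵢ)`) has eventual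
approximation type `a < 1`.  Theorem-grade: Ably 1994 Théorème p. 30 (vendored named fact
`Literature.NumberTheory.Transcendental.Ably1994_lindemannWeierstrass_measure`) through the landed
penalty spine (`stub_penaltyTransfer` p85905, `stub_penaltySlotDichotomy_two` p94631) gives the
penalty form `ApproxTypePenAt 2 s a κ C` with `a = 3/4`, which is the eventual type past the threshold
`H₀(d) = ⌈exp(exp(κ d log(d+2)))⌉`. -/
def EvLWTwo : Prop :=
  ∀ s : Fin 2 → ℂ, (∀ i, IsAlgebraic ℚ (s i)) → LinearIndependent ℚ s →
    ∃ a b C : ℝ, a < 1 ∧ ApproxTypeEvAt 2 s a b C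

/-- `EvNonLWTwo` — the NON-LINDEMANN–WEIERSTRASS LAYER at `n = 2` (OPEN, Schanuel-rank-2 strength
pointwise): every free Khovanskii point `s ∈ ℂ²` with `ℚ`-linearly independent coordinates one of
which is transcendental has eventual approximation type `a < 1`.  At `s = (1, iπ)` this is the route
item `EPiSimultaneousTypeEv` (e ⊥ π with a measure); other species `(1, log 2)`, `(log 2, log 3)`,
`(iπ, π)`, implicit Lambert-type points — all conceded (`LargeTranscendenceDegree`,
`AlgebraicIndependenceOfLogarithms`).  After the anchored reduction the ROUTE needs it only at `(1, iπ)`. -/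
def EvNonLWTwo : Prop :=
  ∀ s : Fin 2 → ℂ, LinearIndependent ℚ s → IsFreeKhovanskii 2 s → (∃ i, Transcendental ℚ (s i)) →
    ∃ a b C : ℝ, a < 1 ∧ ApproxTypeEvAt 2 s a b C

/-- `EvRankThreeUp` — the RESIDUAL: the eventual crux at free Khovanskii points of `ℂⁿ`, `n ≥ 3`
(OPEN, crux-sized: it IS the crux for `n ≥ 3`; typed-currency cap `(n+1)/(2n) ≥ 1/(n−1)` of the
transfer architecture even at Lindemann–Weierstrass points).  Carried so that the skeleton concludes the
`∀ n ≥ 2` crux by name; after the anchored reduction the ROUTE needs it only at `(1, iπ, s₃, …)`. -/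
def EvRankThreeUp : Prop :=
  ∀ (n : ℕ) (s : Fin n → ℂ), 3 ≤ n → LinearIndependent ℚ s → IsFreeKhovanskii n s →
    ∃ a b C : ℝ, a < 1 / ((n : ℝ) - 1) ∧ ApproxTypeEvAt n s a b C

end Summit.Schanuel.Schanuel.Cruxes.KhovanskiiApproxTypeEv.AnchoredReduction

end

/-!
## Appendix (lead a3, 2026-08-17): the MINIMAL race input (liminf / single-level form)

Restatement input R4 of the crux chain (ideator round 2 / k5, `Cruxes/KhovanskiiApproxTypeEv/
IdeatorR2K5Notes.md` §4, checked file `SketchIdeatorR2K5.lean`), landed as vocabulary so that the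
proofs in `Theorems/DiophantineDichotomyKhovanskiiApproxTypeEvRaceLiminf.lean` and a restated route
can name it.  The route's exponent race at `θ = (s, e^s)` with approximation-property constant `c`
needs the measure only at ONE degree level `D = (cΔ)ᵗ` (`t = n − 1`) with exponent `ε·D^{1/t}`,
`ε < 1/c²`, eventually in the height; quantified over the unknown `c` this is "for every `ε > 0`
there are infinitely many levels `D` at which, eventually in `H`, every challenger of level `(D, H)`
stays at distance `≥ exp(−(ε·D^{1/(n−1)}·log H + κ))`" — no exponent `a`, no constant `C`, no `dᵇ`
term, no "for all `d`".  It is implied by the crux (`khovanskiiRaceInput_of_ev`) and still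
race-sufficient (`approximationRaceLiminf`, both proved in the `…RaceLiminf` file); like every
race-sufficient input it yields `2 ≤ trdeg` pointwise (R2, p124730), so it is not easier than
Schanuel at any point — it is only the honest minimum of what the route asserts beyond Schanuel.
Nothing here is asserted: three predicates/statements and one implication-statement.
-/

noncomputable section

-- as above: `Summit.Schanuel.Schanuel.…` is the mandated namespace of this single-conjunct summit
set_option linter.dupNamespace false

namespace Summit.Schanuel.Schanuel.Cruxes.KhovanskiiApproxTypeEv.RaceInput

open Summit.Schanuel.Schanuel.Theses.DiophantineDichotomy (ApproximationProperty KhovanskiiSchanuel)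
open Summit.Schanuel.Schanuel.Cruxes.KhovanskiiApproxType.LwSmallHeight (IsFreeKhovanskii)

/-- Challenger `γ ∈ ℂ²ⁿ` is of LEVEL `(D, H)`: field degree `[ℚ(γ):ℚ] ≤ D` and every coordinate a
root of a non-zero integer polynomial of degree `≤ D` and naive height `≤ H` — verbatim the two
admissibility clauses of the crux `KhovanskiiApproxTypeEv` (there with `D = d`). -/
def IsLevel (n D H : ℕ) (γ : Fin n ⊕ Fin n → ℂ) : Prop :=
  Module.finrank ℚ ↥(IntermediateField.adjoin ℚ (Set.range γ)) ≤ D ∧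
    ∀ i, ∃ P : Polynomial ℤ, P ≠ 0 ∧ P.natDegree ≤ D ∧ (∀ k, |P.coeff k| ≤ (H : ℤ)) ∧
      Polynomial.aeval (γ i) P = 0

/-- **The minimal race input at `θ = (s, e^s) ∈ ℂ²ⁿ` (liminf / single-level form, R4).**  For every
`ε > 0` and every `D₀` there is a degree level `D ≥ D₀`, an additive constant `κ` and a height
threshold `H₀` such that every challenger `γ` of level `(D, H)` with `H ≥ H₀` satisfies
`‖γ − θ‖ ≥ exp(−(ε · D^{1/(n−1)} · log H + κ))` (sup norm).  Equivalently
`liminf_D w_D(θ)/D^{1/(n−1)} = 0` for the eventual exponent `w_D` of level-`D` approximation. -/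
def RaceInputAt (n : ℕ) (s : Fin n → ℂ) : Prop :=
  ∀ ε : ℝ, 0 < ε → ∀ D₀ : ℕ, ∃ D : ℕ, D₀ ≤ D ∧ ∃ (κ : ℝ) (H₀ : ℕ),
    ∀ (H : ℕ) (γ : Fin n ⊕ Fin n → ℂ), H₀ ≤ H → IsLevel n D H γ →
      Real.exp (-(ε * (D : ℝ) ^ (1 / ((n : ℝ) - 1)) * Real.log H + κ)) ≤
        ‖γ - Sum.elim s (Complex.exp ∘ s)‖

/-- `KhovanskiiRaceInput` — the minimal race input `RaceInputAt n s` at every free Khovanskii point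
`s ∈ ℂⁿ`, `n ≥ 2`, with `ℚ`-linearly independent coordinates: the candidate RESTATED Diophantine crux
of route `DiophantineDichotomy` (strictly weaker than `KhovanskiiApproxTypeEv`, which gives it by
`khovanskiiRaceInput_of_ev`). -/
def KhovanskiiRaceInput : Prop :=
  ∀ (n : ℕ) (s : Fin n → ℂ), 2 ≤ n → LinearIndependent ℚ s → IsFreeKhovanskii n s → RaceInputAt n s

/-- `ApproximationRaceLiminf` — THE RACE FROM THE MINIMAL INPUT (statement): Philippon's
approximation property and `KhovanskiiRaceInput` give Schanuel at free Khovanskii points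
(`KhovanskiiSchanuel`).  Proved as `approximationRaceLiminf` in
`Theorems/DiophantineDichotomyKhovanskiiApproxTypeEvRaceLiminf.lean` (race compactness at one level). -/
def ApproximationRaceLiminf : Prop :=
  ApproximationProperty → KhovanskiiRaceInput → KhovanskiiSchanuel

end Summit.Schanuel.Schanuel.Cruxes.KhovanskiiApproxTypeEv.RaceInput

end
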